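import Literature.Computability.Cryptography.PeriodisedFourierTransform
import Literature.Computability.Cryptography.VanDamSeroussiEigenstate
import HarnessLib

/-!
# The character state through the approximate Fourier transform over `ℤ_p`

Topic `Literature/Computability/Cryptography`; support for the discharge of
`VanDamSeroussi2002_gaussSumPhase_qsolvable` (van Dam–Seroussi 2002, §4 Algorithm 1 / Thm. 1),
combining `VanDamSeroussiEigenstate.lean` (§2.1 Fact 1: `Σ_x χ(x) e(cx) = χ⁻¹(c) G(χ, e)`; §4
Algorithm 1: `F_p|χ⟩ = (G/√p)|χ⁻¹⟩`) with `PeriodisedFourierTransform.lean` (Hales 2002, Ch. 5 §1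
Algorithm 3 / Ch. 9 §2 Thm. 10: the transform over `ℤ_Q` of the `R`-fold repetition of a basis state
`|x⟩`, `x < p`, is within `√p(πRp/Q + 2/√R)` of `Σ_i (F_p)_{ix} |b_0⟩^{(i')}` =
`Hales2002.target p R Q x`). The circuit of the algorithm applies that approximate transform to the
SUPERPOSITION `|χ⟩ = (p−1)^{-1/2} Σ_x χ(x)|x⟩`; this file proves what it does to it:

* `Hales2002.norm_e_sub_one_le` — `‖e(u) − 1‖ ≤ 2π|u|` (for the binary-digit phases of the circuit);
* **`norm_toE_sum_repFT_sub_target_le`** — linearity and the triangle inequality: for coefficients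
  `c`, `‖Σ_x c_x (F_Q rep_R x − target_x)‖ ≤ (Σ_x |c_x|) · √p(πRp/Q + 2/√R)`;
* `sum_range_mulChar_mul_e`, `sum_range_mulChar_mul_fpEntry` — Fact 1 in the coordinates of the
  transform: `Σ_{x<p} χ(x) (F_p)_{ix} = p^{-1/2} χ⁻¹(i) G(χ, e)`;
* **`sum_range_mulChar_mul_target`** — the target of the character state:
  `Σ_{x<p} χ(x) · target_x(y) = p^{-1/2} G(χ, e) · Σ_{i<p} χ⁻¹(i) bump_i(y)`, i.e. after the
  division step the residue register carries `(G/√p)|χ⁻¹⟩` against the fixed bump — Algorithm 1's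
  `F|χ⟩ = (G(χ)/√p)|χ⁻¹⟩` realised by the periodised transform;
* `mulChar_pow_eq_e` — the character values as phases: `χ(g) = e(a/(p−1))` gives
  `χ(g^d) = e(a d/(p−1))` (§2.1: `χ(g^j) = ζ_{p−1}^{αj}`), the form the circuit imprints digit by digit.

Everything is proved; no definition, no named fact.

## References

* W. van Dam, G. Seroussi, *Efficient quantum algorithms for estimating Gauss sums*,
  arXiv:quant-ph/0207131 (2002), §2.1 (Fact 1), §3 (Lemma 1), §4 (Algorithm 1, Thm. 1)
  [VanDamSeroussi2002].
* L. Hales, *The quantum Fourier transform and extensions of the abelian hidden subgroup problem*,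
  PhD thesis, UC Berkeley 2002 (arXiv:quant-ph/0212002), Ch. 5 §1, Ch. 9 §2 Thm. 10 [Hales2002].
-/

noncomputable section

open Finset Real Complex

namespace Literature.Computability.Cryptography

namespace Hales2002

/-! ### Phases are Lipschitz -/

/-- **`‖e(u) − 1‖ ≤ 2π|u|`** (so `‖e(s) − e(t)‖ = ‖e(s − t) − 1‖ ≤ 2π|s − t|`: `e` is `2π`-Lipschitz).
[folklore] -/
theorem norm_e_sub_one_le (u : ℝ) : ‖e u - 1‖ ≤ 2 * π * |u| := by
  rw [e_eq_cexp, show (2 : ℂ) * π * I * u = I * ((2 * π * u : ℝ) : ℂ) by push_cast; ring]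
  refine (Real.norm_exp_I_mul_ofReal_sub_one_le).trans (le_of_eq ?_)
  rw [Real.norm_eq_abs, abs_mul, abs_of_pos (by positivity : (0 : ℝ) < 2 * π)]

/-- `‖e(t)(e(u) − 1)‖ ≤ 2π|u|`: the difference of two phases `e(t + u) − e(t)`. [folklore] -/
theorem norm_e_mul_e_sub_one_le (t u : ℝ) : ‖e t * (e u - 1)‖ ≤ 2 * π * |u| := by
  rw [norm_mul, norm_e, one_mul]
  exact norm_e_sub_one_le u

/-! ### Superpositions through the periodised transform -/

/-- **A superposition through the approximate transform**: for coefficients `c` on `x < p`,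
`‖Σ_x c_x (F_Q rep_R x − target_x)‖ ≤ (Σ_x |c_x|) · √p (πRp/Q + 2/√R)` (linearity of the transform,
triangle inequality, and the basis-input bound). [cite: Hales2002, Ch. 9 §2 Thm. 10 (the bound for a general unit vector follows from the basis case)] -/
theorem norm_toE_sum_repFT_sub_target_le {p R Q : ℕ} (hp : 0 < p) (hR : 0 < R) (hRQ : R * p ≤ Q)
    (hpQ : 4 * p ≤ Q) (c : ℕ → ℂ) :
    ‖toE Q (fun y => ∑ x ∈ range p, c x * (repFT p R Q x y - target p R Q x y))‖ ≤
      (∑ x ∈ range p, ‖c x‖) * (Real.sqrt p * (π * R * p / Q + 2 / Real.sqrt R)) := by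
  rw [toE_sum, Finset.sum_mul]
  refine (norm_sum_le _ _).trans (Finset.sum_le_sum fun x hx => ?_)
  rw [toE_smul, norm_smul]
  refine mul_le_mul_of_nonneg_left ?_ (norm_nonneg _)
  rw [norm_toE]
  exact sqrt_sum_norm_sq_repFT_sub_target_le hp hR hRQ hpQ (mem_range.1 hx)

end Hales2002

namespace VanDamSeroussi

open Hales2002

variable {p : ℕ} [hp : Fact p.Prime]

/-! ### Fact 1 in the coordinates of the transform -/

/-- The phase `e(ix/p)` is the additive character `e_p` at `i·x`. [folklore] -/
theorem e_mul_div_eq_stdAddChar (i x : ℕ) :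
    e ((i : ℝ) * x / p) = ZMod.stdAddChar (((i * x : ℕ) : ZMod p)) := by
  rw [ZMod.stdAddChar_apply, ZMod.toCircle_natCast, e_eq_cexp]
  congr 1
  push_cast
  ring

/-- **The character sum over `x < p` against `e(ix/p)` is the sum over `ZMod p`.** [folklore] -/
theorem sum_range_mulChar_mul_e (χ : MulChar (ZMod p) ℂ) (i : ℕ) :
    ∑ x ∈ range p, χ (x : ZMod p) * e ((i : ℝ) * x / p) = ∑ x : ZMod p, χ x * ZMod.stdAddChar ((i : ZMod p) * x) := by
  refine Finset.sum_nbij' (fun z : ℕ => (z : ZMod p)) ZMod.val (fun _ _ => Finset.mem_univ _)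
    (fun a _ => Finset.mem_range.mpr (ZMod.val_lt a))
    (fun z hz => ZMod.val_natCast_of_lt (Finset.mem_range.mp hz))
    (fun a _ => ZMod.natCast_zmod_val a) (fun z _ => ?_)
  rw [e_mul_div_eq_stdAddChar, Nat.cast_mul]

/-- **Fact 1 for the entries of `F_p`**: `Σ_{x<p} χ(x) (F_p)_{ix} = p^{-1/2} χ⁻¹(i) G(χ, e)` for a
non-trivial `χ`. [cite: VanDamSeroussi2002, §2.1 Fact 1] -/
theorem sum_range_mulChar_mul_fpEntry {χ : MulChar (ZMod p) ℂ} (hχ : χ ≠ 1) (i : ℕ) :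
    ∑ x ∈ range p, χ (x : ZMod p) * fpEntry p i x =
      (((Real.sqrt p)⁻¹ : ℝ) : ℂ) * (χ⁻¹ (i : ZMod p) * gaussSum χ ZMod.stdAddChar) := by
  have h : ∀ x ∈ range p, χ (x : ZMod p) * fpEntry p i x = (((Real.sqrt p)⁻¹ : ℝ) : ℂ) * (χ (x : ZMod p) * e ((i : ℝ) * x / p)) := by
    intro x _; rw [fpEntry]; ring
  rw [Finset.sum_congr rfl h, ← Finset.mul_sum, sum_range_mulChar_mul_e, sum_mulChar_mul_stdAddChar hχ]

/-- **The target of the character state** [VanDamSeroussi2002, §4 Algorithm 1 through Hales's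
transform]: `Σ_{x<p} χ(x) · target_x(y) = p^{-1/2} G(χ, e) · Σ_{i<p} χ⁻¹(i) bump_i(y)` — the residue
register carries `(G(χ, e)/√p) |χ⁻¹⟩` against the fixed bump.
[cite: VanDamSeroussi2002, §4 Algorithm 1 (F|χ⟩ = (G/√p)|χ⁻¹⟩)] [cite: Hales2002, Ch. 9 §2 Thm. 10] -/
theorem sum_range_mulChar_mul_target {χ : MulChar (ZMod p) ℂ} (hχ : χ ≠ 1) (R Q y : ℕ) :
    ∑ x ∈ range p, χ (x : ZMod p) * target p R Q x y =
      (((Real.sqrt p)⁻¹ : ℝ) : ℂ) * gaussSum χ ZMod.stdAddChar * ∑ i ∈ range p, χ⁻¹ (i : ZMod p) * bump p R Q i y := by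
  calc ∑ x ∈ range p, χ (x : ZMod p) * target p R Q x y
      = ∑ x ∈ range p, ∑ i ∈ range p, χ (x : ZMod p) * fpEntry p i x * bump p R Q i y := by
        refine Finset.sum_congr rfl fun x _ => ?_
        rw [target, Finset.mul_sum]
        refine Finset.sum_congr rfl fun i _ => ?_; ring
    _ = ∑ i ∈ range p, (∑ x ∈ range p, χ (x : ZMod p) * fpEntry p i x) * bump p R Q i y := by
        rw [Finset.sum_comm]
        refine Finset.sum_congr rfl fun i _ => ?_
        rw [Finset.sum_mul]
    _ = ∑ i ∈ range p, (((Real.sqrt p)⁻¹ : ℝ) : ℂ) * gaussSum χ ZMod.stdAddChar * (χ⁻¹ (i : ZMod p) * bump p R Q i y) := by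
        refine Finset.sum_congr rfl fun i _ => ?_
        rw [sum_range_mulChar_mul_fpEntry hχ]; ring
    _ = _ := by rw [← Finset.mul_sum]

/-- **The transform of the character state, with the error of the periodisation**: for coefficients
`c_x = χ(x) · w` (`w` a normalisation), the transformed repeated state is within
`(Σ_{x<p} |χ(x)|)·|w|·√p(πRp/Q + 2/√R)` of `w p^{-1/2} G(χ, e) · Σ_i χ⁻¹(i) bump_i`.
[cite: VanDamSeroussi2002, §4 Algorithm 1] [cite: Hales2002, Ch. 9 §2 Thm. 10] -/
theorem norm_toE_transform_mulChar_sub_le {χ : MulChar (ZMod p) ℂ} (hχ : χ ≠ 1) {R Q : ℕ} (hR : 0 < R)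
    (hRQ : R * p ≤ Q) (hpQ : 4 * p ≤ Q) (w : ℂ) :
    ‖toE Q (fun y => ∑ x ∈ range p, χ (x : ZMod p) * w * repFT p R Q x y) -
        toE Q (fun y => w * ((((Real.sqrt p)⁻¹ : ℝ) : ℂ) * gaussSum χ ZMod.stdAddChar) *
          ∑ i ∈ range p, χ⁻¹ (i : ZMod p) * bump p R Q i y)‖ ≤
      (∑ x ∈ range p, ‖χ (x : ZMod p)‖) * ‖w‖ * (Real.sqrt p * (π * R * p / Q + 2 / Real.sqrt R)) := by
  have hp0 : 0 < p := hp.out.pos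
  have key := norm_toE_sum_repFT_sub_target_le hp0 hR hRQ hpQ (fun x => χ (x : ZMod p) * w)
  have hsum : ∑ x ∈ range p, ‖χ (x : ZMod p) * w‖ = (∑ x ∈ range p, ‖χ (x : ZMod p)‖) * ‖w‖ := by
    rw [Finset.sum_mul]
    exact Finset.sum_congr rfl fun x _ => norm_mul _ _
  rw [hsum] at key
  have htgt : ∀ y, ∑ x ∈ range p, χ (x : ZMod p) * w * target p R Q x y =
      w * ((((Real.sqrt p)⁻¹ : ℝ) : ℂ) * gaussSum χ ZMod.stdAddChar) * ∑ i ∈ range p, χ⁻¹ (i : ZMod p) * bump p R Q i y := by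
    intro y
    have : ∑ x ∈ range p, χ (x : ZMod p) * w * target p R Q x y = w * ∑ x ∈ range p, χ (x : ZMod p) * target p R Q x y := by
      rw [Finset.mul_sum]
      exact Finset.sum_congr rfl fun x _ => by ring
    rw [this, sum_range_mulChar_mul_target hχ]; ring
  have hfun : ∀ y, ∑ x ∈ range p, χ (x : ZMod p) * w * repFT p R Q x y -
      w * ((((Real.sqrt p)⁻¹ : ℝ) : ℂ) * gaussSum χ ZMod.stdAddChar) * ∑ i ∈ range p, χ⁻¹ (i : ZMod p) * bump p R Q i y =
      ∑ x ∈ range p, χ (x : ZMod p) * w * (repFT p R Q x y - target p R Q x y) := by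
    intro y
    rw [← htgt, ← Finset.sum_sub_distrib]
    exact Finset.sum_congr rfl fun x _ => by ring
  have hvec : toE Q (fun y => ∑ x ∈ range p, χ (x : ZMod p) * w * repFT p R Q x y) -
      toE Q (fun y => w * ((((Real.sqrt p)⁻¹ : ℝ) : ℂ) * gaussSum χ ZMod.stdAddChar) *
        ∑ i ∈ range p, χ⁻¹ (i : ZMod p) * bump p R Q i y) =
      toE Q (fun y => ∑ x ∈ range p, χ (x : ZMod p) * w * (repFT p R Q x y - target p R Q x y)) := by
    rw [← toE_sub]
    exact congrArg (toE Q) (funext hfun)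
  rw [hvec]
  exact key

/-- `Σ_{x<p} |χ(x)| = p − 1` for a multiplicative character of `𝔽_p` (units have modulus one, `χ(0) = 0`).
[folklore] -/
theorem sum_range_norm_mulChar (χ : MulChar (ZMod p) ℂ) : ∑ x ∈ range p, ‖χ (x : ZMod p)‖ = p - 1 := by
  have hp1 : 1 ≤ p := hp.out.one_le
  rw [Finset.range_eq_Ico, ← Finset.sum_Ico_consecutive _ (Nat.zero_le 1) hp1, Finset.sum_Ico_succ_top (Nat.zero_le 0),
    Finset.Ico_self, Finset.sum_empty, zero_add, Nat.cast_zero, MulChar.map_zero, norm_zero, zero_add]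
  have h : ∀ x ∈ Finset.Ico 1 p, ‖χ (x : ZMod p)‖ = 1 := by
    intro x hx
    rw [Finset.mem_Ico] at hx
    refine norm_mulChar_apply_of_isUnit χ ?_
    rw [isUnit_iff_ne_zero, Ne, ZMod.natCast_eq_zero_iff]
    exact fun hd => absurd (Nat.le_of_dvd (by omega) hd) (by omega)
  rw [Finset.sum_congr rfl h, Finset.sum_const, Nat.card_Ico, nsmul_eq_mul, mul_one, Nat.cast_sub hp1, Nat.cast_one]

/-! ### Character values as phases -/

/-- **The character values along the powers of the primitive root**: if `χ(g) = e(a/(p−1))` then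
`χ(g^d) = e(a d/(p−1))` for every `d`. [cite: VanDamSeroussi2002, §2.1 (χ(g^j) = ζ_{p^r−1}^{αj})] -/
theorem mulChar_pow_eq_e (χ : MulChar (ZMod p) ℂ) {g : ZMod p} {a : ℕ}
    (hχ : χ g = e ((a : ℝ) / ((p : ℝ) - 1))) (d : ℕ) :
    χ (g ^ d) = e ((a : ℝ) * d / ((p : ℝ) - 1)) := by
  induction d with
  | zero => simp [e_eq_cexp]
  | succ d ih =>
    rw [pow_succ, map_mul, ih, hχ, ← e_add]
    congr 1
    push_cast
    ring

/-- The same with the exponent reduced modulo `p − 1` (`e` has period one). [cite: VanDamSeroussi2002, §2.1] -/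
theorem mulChar_pow_eq_e_mod (χ : MulChar (ZMod p) ℂ) {g : ZMod p} {a : ℕ}
    (hχ : χ g = e ((a : ℝ) / ((p : ℝ) - 1))) (d : ℕ) :
    χ (g ^ d) = e (((a * d % (p - 1) : ℕ) : ℝ) / ((p : ℝ) - 1)) := by
  have hp2 := hp.out.two_le
  have hp1 : ((p : ℝ) - 1) = ((p - 1 : ℕ) : ℝ) := by rw [Nat.cast_sub (by omega)]; simp
  have hp1' : ((p - 1 : ℕ) : ℝ) ≠ 0 := by exact_mod_cast (by omega : p - 1 ≠ 0)
  rw [mulChar_pow_eq_e χ hχ d, hp1]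
  have hdm : ((a * d : ℕ) : ℝ) = ((p - 1 : ℕ) : ℝ) * ((a * d / (p - 1) : ℕ) : ℝ) + ((a * d % (p - 1) : ℕ) : ℝ) := by
    exact_mod_cast (Nat.div_add_mod (a * d) (p - 1)).symm
  have key : (a : ℝ) * d / ((p - 1 : ℕ) : ℝ) =
      ((a * d % (p - 1) : ℕ) : ℝ) / ((p - 1 : ℕ) : ℝ) + ((a * d / (p - 1) : ℕ) : ℝ) := by
    rw [show (a : ℝ) * d = ((a * d : ℕ) : ℝ) by push_cast; ring, hdm]
    field_simp
    ring
  have h := e_add_intCast (((a * d % (p - 1) : ℕ) : ℝ) / ((p - 1 : ℕ) : ℝ)) ((a * d / (p - 1) : ℕ) : ℤ)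
  rw [Int.cast_natCast] at h
  rw [key]
  exact h

end VanDamSeroussi

end Literature.Computability.Cryptography

end
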